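import Literature.AnabelianGeometry.EtaleTheta.Discharge.Sec5ThetaDivisorOrbitLiftToRoot

/-!
# [EtTh] Thm. 5.6/5.7 via Prop. 5.3 (vi), LINK (d) — divisor glue: `e · Div(s) = Div(e⁻¹ ∘ s)` (sequel to `Sec5ThetaDivisorOrbitLiftToRoot`)

Mochizuki, *The étale theta function …*, Publ. RIMS **45** (2009), proof of Thm. 5.6 p.329 (PDF p.103); [FrdI] Thm. 5.2 (ii)
p.101 (isomorphisms of the model Frobenioid have `Div = 0`, `deg_Fr = 1`).  The LINK (d) file produces `e ∈ Aut_C(A_N)` with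
`Φ^gp(a)((Ψ^Φ)^gp div Θ̈) = e · Φ^gp(a)(div Θ̈)`, `e · x := ((e⁻¹)^bs)^* x`.  To land in abc-iut-L2-d4's `∃ e`-form at the pair
(`Div(α⁻¹ ≫ Ψ s ≫ β) = Div(e ≫ s)`) the assembler (abc-iut-w5-d245, GAP G-w5d245-2) needs the one-line dictionary
`e · Div(s) = Div(e⁻¹ ≫ s)` for morphisms `s` out of `A_N` (an isomorphism is an isometry over a sharp `Φ`: [FrdI] Rmk. 1.1.1 /
Thm. 5.2 (ii)) — generic over the §5 data under `Div(e⁻¹) = 0`, and at the genuine data `ofConnectedTemperoidData …` (`Φ`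
divisorial) with no hypothesis, in `pull`/`pullGp` currency (quotients `Div(s)·Div(s′)⁻¹ ∈ Φ^gp` generically; by `map_div` at the data).
[cite: MochizukiEtTh2009, Thm 5.6 proof p.329 (PDF p.103)] [cite: MochizukiFrdI2008, Thm. 5.2(ii) p.101]

abc-iut cell, layer L2, R314 sequel (seat abc-iut-f-123 gen 3).  PROOF-ONLY (0 definitions).  HONEST FRAMING: bookkeeping over the
typed structures; typed ≠ proved; no side taken on [IUTchIII] Cor. 3.12.
-/

open CategoryTheory Opposite

namespace Literature.AnabelianGeometry.EtaleTheta

open Literature.AlgebraicGeometry.Frobenioids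

universe w v v' u u'

namespace ThetaFrobenioid

section Generic

variable {C : Type u} [Category.{v} C] {D : Type u'} [Category.{v'} D] (𝔉 : ThetaFrobenioid.{w} C D)

/-- **`e · Div(s) = Div(e⁻¹ ≫ s)`** for `e ∈ Aut_C(S)` with `Div(e⁻¹) = 0` and any `s : S → T` ([FrdI] Rmk. 1.1.1:
`Div(e⁻¹ ≫ s) = ((e⁻¹)^bs)^* Div(s) · Div(e⁻¹)^{deg_Fr s}`).  [cite: MochizukiFrdI2008, Thm. 5.2(ii) p.101] -/
theorem pullAut_div_eq_div_inv_comp {S T : C} (e : Aut S) (s : S ⟶ T) (he : 𝔉.pre.div e.inv = 1) :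
    𝔉.pullAut e (𝔉.pre.div s) = 𝔉.pre.div (e.inv ≫ s) := by
  rw [pullAut_apply, 𝔉.pre.div_comp, he, one_pow, mul_one]

/-- The same on `Φ^gp`: `(e ·)^gp [Div s] = [Div(e⁻¹ ≫ s)]`. [cite: MochizukiFrdI2008, Thm. 5.2(ii) p.101] -/
theorem gpMap_pullAut_of_div {S T : C} (e : Aut S) (s : S ⟶ T) (he : 𝔉.pre.div e.inv = 1) :
    ThetaFrobenioid.gpMap (𝔉.pullAut e : 𝔉.pre.Mon (𝔉.base.obj S) →* 𝔉.pre.Mon (𝔉.base.obj S))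
        (Algebra.GrothendieckGroup.of (𝔉.pre.div s)) =
      Algebra.GrothendieckGroup.of (𝔉.pre.div (e.inv ≫ s)) := by
  rw [ThetaFrobenioid.gpMap_of, MonoidHom.coe_coe, pullAut_div_eq_div_inv_comp 𝔉 e s he]

/-- … and on quotients `[Div s]·[Div s′]⁻¹ ∈ Φ^gp` (the shape of a divisor of zeroes and poles).
[cite: MochizukiFrdI2008, Thm. 5.2(ii) p.101] -/
theorem gpMap_pullAut_of_div_div {S T T' : C} (e : Aut S) (s : S ⟶ T) (s' : S ⟶ T') (he : 𝔉.pre.div e.inv = 1) :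
    ThetaFrobenioid.gpMap (𝔉.pullAut e : 𝔉.pre.Mon (𝔉.base.obj S) →* 𝔉.pre.Mon (𝔉.base.obj S))
        (Algebra.GrothendieckGroup.of (𝔉.pre.div s) / Algebra.GrothendieckGroup.of (𝔉.pre.div s')) =
      Algebra.GrothendieckGroup.of (𝔉.pre.div (e.inv ≫ s)) / Algebra.GrothendieckGroup.of (𝔉.pre.div (e.inv ≫ s')) := by
  rw [map_div, gpMap_pullAut_of_div 𝔉 e s he, gpMap_pullAut_of_div 𝔉 e s' he]

end Generic

/-! ## At the genuine §5 data `ofConnectedTemperoidData …`: `Div(e⁻¹) = 0` is automatic (`Φ` divisorial) -/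

section ConnectedTemperoidData

open Literature.AnabelianGeometry.SemiGraphs

universe u₀ v₀ w₀

variable {K : Type u₀} [Field K] {X : SemiGraphs.TemperedArithmeticGroup.{u₀} K} {D₀ : Type u₀} [Category.{v₀} D₀]
  {V : FrdIMonoidStub.{w₀}} {T₀ : RealifiedDivisorMonoids (D₀ := D₀) V}
  {VD : FrdICatStub.{u₀ + 1, u₀, w₀} (ConnectedPart (BTemp X.Pi))}
  {tf : TemperedFrobenioid T₀ (ConnectedPart (BTemp X.Pi)) VD} {hZ : tf.monoidType = MonoidType.Z}
  {hP : ∀ A : (ConnectedPart (BTemp X.Pi))ᵒᵖ, IsPerfect (tf.Φ.carrier A)}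
  {NH : Subgroup (Field.absoluteGaloisGroup K) → tf.category → ℕ+ → Prop} {A₀ : tf.category}
  {hA₀ : PreFrobenioid.IsFrobeniusTrivial tf.toElem A₀} {hA₀' : SemiGraphs.IsGaloisObj A₀.base.obj}
  {lv N : ℕ+} {T : ThetaEnvData.{max u₀ w₀} N}
  {pullFrac : ∀ {A A' : (BiKummerSetting.mkOfConnectedTemperoid X tf hZ hP NH A₀ hA₀ hA₀').C} (_ : A' ⟶ A),
    (BiKummerSetting.mkOfConnectedTemperoid X tf hZ hP NH A₀ hA₀ hA₀').biratUnits A →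
      (BiKummerSetting.mkOfConnectedTemperoid X tf hZ hP NH A₀ hA₀ hA₀').biratUnits A'}
  {θ : (BiKummerSetting.mkOfConnectedTemperoid X tf hZ hP NH A₀ hA₀ hA₀').biratUnits
    (BiKummerSetting.mkOfConnectedTemperoid X tf hZ hP NH A₀ hA₀ hA₀').Aodot}
  {Bl : (BiKummerSetting.mkOfConnectedTemperoid X tf hZ hP NH A₀ hA₀ hA₀').C}
  {Pl : (BiKummerSetting.mkOfConnectedTemperoid X tf hZ hP NH A₀ hA₀ hA₀').FractionPair θ Bl}
  {Rl : (BiKummerSetting.mkOfConnectedTemperoid X tf hZ hP NH A₀ hA₀ hA₀').NthRoot θ Pl lv pullFrac}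
  (h : ModelFrobenioid.Hypotheses tf.divisorMonoid tf.ratFnFunctor)
  (Q : FrobenioidTheta.ThetaSubquotientStub.{w₀} (ConnectedPart (BTemp X.Pi))) (odd_l : Odd (lv : ℕ))
  (R : (BiKummerSetting.mkOfConnectedTemperoid X tf hZ hP NH A₀ hA₀ hA₀').NthRoot Rl.root Rl.pair N pullFrac)
  (ιX : T.PiX ≃ₜ* X.Pi) (K' : Type w₀) [Field K'] (constEmb : K'ˣ →* tf.biratUnitsModel R.BN)
  (constEmb_injective : Function.Injective constEmb)
  (hinvc : ∀ g : Aut R.AN.base,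
    pull tf.divisorMonoid g.hom (ModelFrobenioid.div R.pair.num) = ModelFrobenioid.div R.pair.num)
  (hinvp : ∀ y : T.PiX, y ∈ T.PiYdd →
    pull tf.divisorMonoid ((BiKummerSetting.mkOfConnectedTemperoid X tf hZ hP NH A₀ hA₀ hA₀').galoisSurj R.AN.base
      R.αData.isGalois (ιX y)).hom (ModelFrobenioid.div R.pair.den) = ModelFrobenioid.div R.pair.den)

include h in
/-- **`((e⁻¹)^bs)^* Div(s) = Div(e⁻¹ ≫ s)`** in the model currency of the genuine data, for any `e ∈ Aut_C(S′)` and `s : S′ → T′`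
(`Φ` divisorial: `Div(e⁻¹) = 0`; the tree's `ModelFrobenioid.div_comp_of_isIso'`).  [cite: MochizukiFrdI2008, Thm. 5.2(ii) p.101] -/
theorem pull_baseMap_inv_div_ofConnectedTemperoid {S' T' : (BiKummerSetting.mkOfConnectedTemperoid X tf hZ hP NH A₀ hA₀ hA₀').C}
    (e : Aut S') (s : S' ⟶ T') :
    pull tf.divisorMonoid (ModelFrobenioid.baseMap e.inv) (ModelFrobenioid.div s) = ModelFrobenioid.div (e.inv ≫ s) :=
  (ModelFrobenioid.div_comp_of_isIso' h.isDivisorial e.inv s).symm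

include h in
/-- **`Φ^gp((e⁻¹)^bs) [Div s] = [Div(e⁻¹ ≫ s)]`** (`pullGp` currency of the genuine data).  [cite: MochizukiFrdI2008, Thm. 5.2(ii) p.101] -/
theorem pullGp_baseMap_inv_of_div_ofConnectedTemperoid
    {S' T' : (BiKummerSetting.mkOfConnectedTemperoid X tf hZ hP NH A₀ hA₀ hA₀').C} (e : Aut S') (s : S' ⟶ T') :
    pullGp tf.divisorMonoid (ModelFrobenioid.baseMap e.inv) (Algebra.GrothendieckGroup.of (ModelFrobenioid.div s)) =
      Algebra.GrothendieckGroup.of (ModelFrobenioid.div (e.inv ≫ s)) := by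
  rw [pullGp_of, ← pull_baseMap_inv_div_ofConnectedTemperoid h e s]
  rfl

/-- **Prop. 5.3 (vi) READ AT `A_N` — pair-ready form** (genuine data, NO residual hypothesis beyond (vi)): for every base arrow
`a : A_N^bs → A_⊚^bs` there are `g ∈ Aut_C(A_⊚)`, `e ∈ Aut_C(A_N)` over it with `(Ψ^Φ)^gp(div Θ̈) = g · div Θ̈`,
`Φ^gp(a)((Ψ^Φ)^gp div Θ̈) = Φ^gp((e⁻¹)^bs)(Φ^gp(a) div Θ̈)`, AND the pair dictionary for this `e`: for every `s` out of `A_N`,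
`Φ^gp((e⁻¹)^bs)[Div s] = [Div(e⁻¹ ≫ s)]` (whence, by `map_div`/`map_pow`, the same on any word in the `[Div s]`) — so that, once
LINK (b) writes `Φ^gp(a)(div Θ̈)` as a power of `[Div s^⊓_N]·[Div s^⊔_N]⁻¹`, "essentially preserves" becomes abc-iut-L2-d4's `∃ e`
at the pair with witness `e⁻¹`.
[cite: MochizukiEtTh2009, Prop 5.3 (vi) p.326 (PDF p.100); Thm 5.6 proof p.329 (PDF p.103)] -/
theorem exists_aut_AN_of_preservesThetaDivisorOrbit_ofConnectedTemperoidData_pair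
    (a : (ofConnectedTemperoidData h Q odd_l R ιX K' constEmb constEmb_injective hinvc hinvp).base.obj R.AN ⟶
      (ofConnectedTemperoidData h Q odd_l R ιX K' constEmb constEmb_injective hinvc hinvp).base.obj
        (ofConnectedTemperoidData h Q odd_l R ιX K' constEmb constEmb_injective hinvc hinvp).Acirc)
    {𝔓 : FrobenioidThetaDivisors.DivisorPrimeData
      (ofConnectedTemperoidData h Q odd_l R ιX K' constEmb constEmb_injective hinvc hinvp)}
    {Ψ : (BiKummerSetting.mkOfConnectedTemperoid X tf hZ hP NH A₀ hA₀ hA₀').C ≌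
      (BiKummerSetting.mkOfConnectedTemperoid X tf hZ hP NH A₀ hA₀ hA₀').C}
    {ι : Ψ.functor.obj (ofConnectedTemperoidData h Q odd_l R ιX K' constEmb constEmb_injective hinvc hinvp).Acirc ≅
      (ofConnectedTemperoidData h Q odd_l R ιX K' constEmb constEmb_injective hinvc hinvp).Acirc}
    {eΦ : (ofConnectedTemperoidData h Q odd_l R ιX K' constEmb constEmb_injective hinvc hinvp).PhiAcirc ≃*
      (ofConnectedTemperoidData h Q odd_l R ιX K' constEmb constEmb_injective hinvc hinvp).pre.Mon
        ((ofConnectedTemperoidData h Q odd_l R ιX K' constEmb constEmb_injective hinvc hinvp).base.obj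
          (Ψ.functor.obj (ofConnectedTemperoidData h Q odd_l R ιX K' constEmb constEmb_injective hinvc hinvp).Acirc))}
    (hvi : FrobenioidThetaDivisors.PreservesThetaDivisorOrbit 𝔓 Ψ ι eΦ) :
    ∃ (g : Aut (ofConnectedTemperoidData h Q odd_l R ιX K' constEmb constEmb_injective hinvc hinvp).Acirc) (e : Aut R.AN),
      ModelFrobenioid.baseMap e.hom ≫ a = a ≫ ModelFrobenioid.baseMap g.hom ∧
      ThetaFrobenioid.gpMap
          (FrobenioidThetaDivisors.psiPhi _ Ψ ι eΦ :
            (ofConnectedTemperoidData h Q odd_l R ιX K' constEmb constEmb_injective hinvc hinvp).PhiAcirc →*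
              (ofConnectedTemperoidData h Q odd_l R ιX K' constEmb constEmb_injective hinvc hinvp).PhiAcirc) 𝔓.divTheta =
        ThetaFrobenioid.gpMap
          ((ofConnectedTemperoidData h Q odd_l R ιX K' constEmb constEmb_injective hinvc hinvp).pullAut g :
            (ofConnectedTemperoidData h Q odd_l R ιX K' constEmb constEmb_injective hinvc hinvp).PhiAcirc →*
              (ofConnectedTemperoidData h Q odd_l R ιX K' constEmb constEmb_injective hinvc hinvp).PhiAcirc) 𝔓.divTheta ∧
      pullGp tf.divisorMonoid a
          (ThetaFrobenioid.gpMap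
            (FrobenioidThetaDivisors.psiPhi _ Ψ ι eΦ :
              (ofConnectedTemperoidData h Q odd_l R ιX K' constEmb constEmb_injective hinvc hinvp).PhiAcirc →*
                (ofConnectedTemperoidData h Q odd_l R ιX K' constEmb constEmb_injective hinvc hinvp).PhiAcirc) 𝔓.divTheta) =
        pullGp tf.divisorMonoid (ModelFrobenioid.baseMap e.inv) (pullGp tf.divisorMonoid a 𝔓.divTheta) ∧
      ∀ {T' : (BiKummerSetting.mkOfConnectedTemperoid X tf hZ hP NH A₀ hA₀ hA₀').C} (s : R.AN ⟶ T'),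
        pullGp tf.divisorMonoid (ModelFrobenioid.baseMap e.inv) (Algebra.GrothendieckGroup.of (ModelFrobenioid.div s)) =
          Algebra.GrothendieckGroup.of (ModelFrobenioid.div (e.inv ≫ s)) := by
  obtain ⟨g, e, he, hg, hgp⟩ := exists_aut_AN_of_preservesThetaDivisorOrbit_ofConnectedTemperoidData h Q odd_l R ιX K'
    constEmb constEmb_injective hinvc hinvp a hvi
  exact ⟨g, e, he, hg, hgp, fun s => pullGp_baseMap_inv_of_div_ofConnectedTemperoid h e s⟩

end ConnectedTemperoidData

end ThetaFrobenioid

end Literature.AnabelianGeometry.EtaleTheta
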